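import Mathlib
import Literature.NumberTheory.LFunctions.Zhang2022.Section8cStatements
import HarnessLib

/-!
# Zhang (2022) §8 p. 47: the two applications of Lemma 8.2 inside `S_j(𝐚₁₁,𝐚₂₁)` — DISCHARGED

Topic `Literature/NumberTheory/LFunctions/Zhang2022` (Landau–Siegel audit tree; verdict-neutral).
Y. Zhang, *Discrete mean estimates and the Landau–Siegel zero*, arXiv:2211.02515v1 (2022)
[Zhang2022LandauSiegel] — **an unrefereed manuscript under adjudication**; D-0069 campaign, cell
`siegel-zhang`, DISCHARGE lane, front end of the chain `Skeleton.Ded823 c′` (nodes `Z22:§8.u040`,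
`Z22:§8.u041`; tex L2420–L2427, PDF p. 47). Theorem-only. The two theorems prove the typed claims
`Section8cStatements.Step8u040 c′` / `Step8u041 c′` (slice L2-t8, p412011) for `c′ ≥ 0` from the
tree's Lemma 8.2 (`Skeleton.lemma82_holds`, `SkeletonPartTwo`).

Content (p. 47): with `x = P₁/dr`, (8.6) gives `ϰ₁(drm) = (log P₁)⁻¹ (x/m)^{β₆} log(x/m)` for
`m < x` and `0` for `m ≥ x`, so the `m`-sum of `S_j(𝐚₁₁,𝐚₂₁)` (Prop. 7.1 with (8.8)) is `(log P₁)⁻¹`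
times the sum of Lemma 8.2 at `x`, `μ = 6`; `dr < P₁/T` is `x > T`, and `x ≤ P₁ < P`; Lemma 8.2's
`O(𝓛⁻⁶)` divided by `log P₁ = 0.504𝓛⁹` is the printed `O(𝓛⁻¹⁵)` (constant `2C₈₂`). Likewise with
`ϰ₂, P₂ = P^{0.5}T^{−10}, β₇, μ = 7` (`log P₂ ≥ 𝓛⁹/4`, constant `4C₈₂`). The window `m < x` sits
inside the range `m < ⌈PT⁻²⌉` of `Skeleton.Sj` because `P₁, P₂ ≤ PT⁻²` (`params`).

| DAG node | typed claim | theorem | status |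
|---|---|---|---|
| `Z22:§8.u040` | `Section8cStatements.Step8u040 c′` | `step8u040_holds` (`0 ≤ c′`) | DISCHARGED |
| `Z22:§8.u041` | `Section8cStatements.Step8u041 c′` | `step8u041_holds` (`0 ≤ c′`) | DISCHARGED |

WHAT THIS FILE IS NOT: anything about Lemma 8.4, the "simple approximation" `Z22:§8.u044`, (8.11),
or the manuscript's Theorems 1–2 / Landau–Siegel zeros. No definition, no new fact.

## References

* Y. Zhang, arXiv:2211.02515v1 (2022), §8 p. 47 (tex L2420–L2427), Lemma 8.2, (8.6), (8.8);
  (2.21), (2.22). [cite: Zhang2022LandauSiegel, §8 p.47]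
-/

noncomputable section

open Complex Real ComplexConjugate Finset

namespace Literature.NumberTheory.LFunctions.Zhang2022.Section8FrontEnd82

open Literature.NumberTheory.LFunctions.Zhang2022.Skeleton

/-! ## The parameters `P, P₁, P₂, T` for large `D` -/

/-- The elementary comparisons between `P = e^{𝓛⁹}`, `P₁ = P^{0.504}`, `P₂ = P^{0.5}T^{−10}`,
`T = e^{𝓛^{1.1}}` used below, valid once `𝓛 = log D ≥ 2`: `log P₁ = 0.504𝓛⁹`,
`𝓛⁹/4 ≤ log P₂`, `P₁, P₂ ≤ PT⁻²`, `P₁T ≤ P`, `P₂T ≤ P`, `P₁ < P`, `P₂ < P`.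
[cite: Zhang2022LandauSiegel, §2 (2.6), (2.21) p.10; §6 p.30] -/
theorem params {D : ℕ} (hL : 2 ≤ ell D) :
    Real.log (Skeleton.P1 D) = 0.504 * ell D ^ 9 ∧ ell D ^ 9 / 4 ≤ Real.log (Skeleton.P2 D) ∧
      Skeleton.P1 D ≤ bigP D / bigT D ^ 2 ∧ Skeleton.P2 D ≤ bigP D / bigT D ^ 2 ∧
      Skeleton.P1 D * bigT D ≤ bigP D ∧ Skeleton.P2 D * bigT D ≤ bigP D ∧
      Skeleton.P1 D < bigP D ∧ Skeleton.P2 D < bigP D := by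
  set L := ell D with hLdef
  have hL1 : (1 : ℝ) ≤ L := by linarith
  have hL0 : 0 < L := by linarith
  have h11 : L ^ (1.1 : ℝ) ≤ L ^ 2 := by
    rw [← Real.rpow_two]
    exact Real.rpow_le_rpow_of_exponent_le hL1 (by norm_num)
  have hL7 : (128 : ℝ) ≤ L ^ 7 := by
    calc (128 : ℝ) = 2 ^ 7 := by norm_num
      _ ≤ L ^ 7 := by gcongr
  have hL9 : L ^ 9 = L ^ 2 * L ^ 7 := by ring
  have hL2 : 0 ≤ L ^ 2 := by positivity
  have h2 : 128 * L ^ 2 ≤ L ^ 9 := by rw [hL9]; nlinarith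
  have h11' : 0 ≤ L ^ (1.1 : ℝ) := by positivity
  have hP1 : Skeleton.P1 D = Real.exp (0.504 * L ^ 9) := by
    rw [Skeleton.P1, bigP, ← hLdef, ← Real.exp_mul, mul_comm]
  have hT : bigT D = Real.exp (L ^ (1.1 : ℝ)) := by rw [bigT, hLdef]
  have hT2 : bigT D ^ 2 = Real.exp (2 * L ^ (1.1 : ℝ)) := by
    rw [hT, ← Real.exp_nat_mul]; norm_num
  have hP2 : Skeleton.P2 D = Real.exp (0.5 * L ^ 9 - 10 * L ^ (1.1 : ℝ)) := by
    rw [Skeleton.P2, bigP, ← hLdef, ← Real.exp_mul, hT, ← Real.exp_nat_mul, ← Real.exp_sub]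
    norm_num [mul_comm]
  have hP : bigP D = Real.exp (L ^ 9) := by rw [bigP, hLdef]
  refine ⟨?_, ?_, ?_, ?_, ?_, ?_, ?_, ?_⟩
  · rw [hP1, Real.log_exp]
  · rw [hP2, Real.log_exp]; nlinarith
  · rw [hP1, hP, hT2, ← Real.exp_sub, Real.exp_le_exp]; nlinarith
  · rw [hP2, hP, hT2, ← Real.exp_sub, Real.exp_le_exp]; nlinarith
  · rw [hP1, hP, hT, ← Real.exp_add, Real.exp_le_exp]; nlinarith
  · rw [hP2, hP, hT, ← Real.exp_add, Real.exp_le_exp]; nlinarith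
  · rw [hP1, hP, Real.exp_lt_exp]; nlinarith
  · rw [hP2, hP, Real.exp_lt_exp]; nlinarith

/-- For `D ≥ ⌈e²⌉`, `𝓛 = log D ≥ 2`. [cite: Zhang2022LandauSiegel, §2 (2.1) p.4] -/
theorem two_le_ell {D : ℕ} (hD : ⌈Real.exp 2⌉₊ ≤ D) : 2 ≤ ell D := by
  have hexp : Real.exp 2 ≤ D := le_trans (Nat.le_ceil _) (by exact_mod_cast hD)
  exact (Real.le_log_iff_exp_le (lt_of_lt_of_le (Real.exp_pos _) hexp)).mpr hexp

/-! ## (8.6) at `drm`: the weights `ϰ₁, ϰ₂` as Lemma 8.2/8.4 summands -/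

/-- `ϰ₁(km) = (log P₁)⁻¹ (x/m)^{β₆} log(x/m)` for `x = P₁/k`, `m < x` (`k, m ≥ 1`), from (8.6):
`1 − log(km)/log P₁ = log(x/m)/log P₁` and `P₁/(km) = x/m`.
[cite: Zhang2022LandauSiegel, §8 (8.6) p.45] -/
theorem vk1_mul_eq {D : ℕ} (hP1 : 1 < Skeleton.P1 D) {k m : ℕ} (hk : 1 ≤ k) (hm : 1 ≤ m)
    (hmx : ((k * m : ℕ) : ℝ) < Skeleton.P1 D) :
    vk1 D (k * m) =
      ((Real.log (Skeleton.P1 D / k / m) : ℝ) : ℂ) / (Real.log (Skeleton.P1 D) : ℂ) *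
        (((Skeleton.P1 D / k / m : ℝ) : ℂ)) ^ beta6 D := by
  have hk0 : (0 : ℝ) < k := by exact_mod_cast hk
  have hm0 : (0 : ℝ) < m := by exact_mod_cast hm
  have hP0 : 0 < Skeleton.P1 D := by linarith
  have hlogP : Real.log (Skeleton.P1 D) ≠ 0 := (Real.log_pos hP1).ne'
  have hkm : ((k * m : ℕ) : ℝ) = (k : ℝ) * m := by push_cast; ring
  rw [vk1, if_pos hmx]
  have h1 : Skeleton.P1 D / ((k * m : ℕ) : ℝ) = Skeleton.P1 D / k / m := by rw [hkm, div_div]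
  have h2 : (1 - Real.log ((k * m : ℕ) : ℝ) / Real.log (Skeleton.P1 D)) =
      Real.log (Skeleton.P1 D / k / m) / Real.log (Skeleton.P1 D) := by
    rw [div_div, Real.log_div hP0.ne' (by positivity), hkm]
    field_simp
  rw [h1, h2]
  push_cast
  ring

/-- `ϰ₂(km) = (log P₂)⁻¹ (x/m)^{β₇} log(x/m)` for `x = P₂/k`, `m < x`, from (8.6).
[cite: Zhang2022LandauSiegel, §8 (8.6) p.45] -/
theorem vk2_mul_eq {D : ℕ} (hP2 : 1 < Skeleton.P2 D) {k m : ℕ} (hk : 1 ≤ k) (hm : 1 ≤ m)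
    (hmx : ((k * m : ℕ) : ℝ) < Skeleton.P2 D) :
    vk2 D (k * m) =
      ((Real.log (Skeleton.P2 D / k / m) : ℝ) : ℂ) / (Real.log (Skeleton.P2 D) : ℂ) *
        (((Skeleton.P2 D / k / m : ℝ) : ℂ)) ^ beta7 D := by
  have hk0 : (0 : ℝ) < k := by exact_mod_cast hk
  have hm0 : (0 : ℝ) < m := by exact_mod_cast hm
  have hP0 : 0 < Skeleton.P2 D := by linarith
  have hlogP : Real.log (Skeleton.P2 D) ≠ 0 := (Real.log_pos hP2).ne'
  have hkm : ((k * m : ℕ) : ℝ) = (k : ℝ) * m := by push_cast; ring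
  rw [vk2, if_pos hmx]
  have h1 : Skeleton.P2 D / ((k * m : ℕ) : ℝ) = Skeleton.P2 D / k / m := by rw [hkm, div_div]
  have h2 : (1 - Real.log ((k * m : ℕ) : ℝ) / Real.log (Skeleton.P2 D)) =
      Real.log (Skeleton.P2 D / k / m) / Real.log (Skeleton.P2 D) := by
    rw [div_div, Real.log_div hP0.ne' (by positivity), hkm]
    field_simp
  rw [h1, h2]
  push_cast
  ring

/-- `ϰ₁(km) = 0` for `km ≥ P₁` ((8.6)). [cite: Zhang2022LandauSiegel, §8 (8.6) p.45] -/
theorem vk1_mul_eq_zero {D k m : ℕ} (h : Skeleton.P1 D ≤ ((k * m : ℕ) : ℝ)) : vk1 D (k * m) = 0 := by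
  rw [vk1, if_neg (not_lt.mpr h)]

/-- `ϰ₂(km) = 0` for `km ≥ P₂` ((8.6)). [cite: Zhang2022LandauSiegel, §8 (8.6) p.45] -/
theorem vk2_mul_eq_zero {D k m : ℕ} (h : Skeleton.P2 D ≤ ((k * m : ℕ) : ℝ)) : vk2 D (k * m) = 0 := by
  rw [vk2, if_neg (not_lt.mpr h)]

/-! ## `Z22:§8.u040`, `Z22:§8.u041`: the two applications of Lemma 8.2 — DISCHARGED -/

/-- Range bookkeeping: for `1 ≤ k` and `x = Q/k` with `Q ≤ PT⁻²`, the window `m < x` of Lemma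
8.2/8.4 sits inside the range `m < ⌈PT⁻²⌉` of `S_j`. [cite: Zhang2022LandauSiegel, §7 (7.2) p.33] -/
theorem Ico_ceil_subset {D : ℕ} {Q : ℝ} (hQ : Q ≤ bigP D / bigT D ^ 2) {k : ℕ} (hk : 1 ≤ k) :
    Finset.Ico 1 ⌈Q / k⌉₊ ⊆ Finset.Ico 1 (Nsupp D) := by
  apply Finset.Ico_subset_Ico_right
  rw [Nsupp]
  apply Nat.ceil_mono
  have hk0 : (1 : ℝ) ≤ k := by exact_mod_cast hk
  rcases le_or_gt 0 Q with hQ0 | hQ0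
  · exact le_trans (div_le_self hQ0 hk0) hQ
  · have h1 : Q / k ≤ 0 := div_nonpos_of_nonpos_of_nonneg hQ0.le (by linarith)
    have hP : 0 < bigP D := Real.exp_pos _
    have hT : 0 < bigT D := Real.exp_pos _
    have h2 : (0 : ℝ) ≤ bigP D / bigT D ^ 2 := by positivity
    linarith

/-- **`Z22:§8.u040` DISCHARGED** (`Section8cStatements.Step8u040 c′`, for `c′ ≥ 0`):
"By Lemma 8.2 with `x = P₁/dr` … `Σ_m χ(m)ϰ₁(drm)/m^{1−β_j} = (L′(1,χ)/log P₁)𝓕_{j6}(P₁/dr) + O(𝓛⁻¹⁵)`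
if `dr < P₁/T`" — from the tree's Lemma 8.2 (`Skeleton.lemma82_holds`) and (8.6); the constant is
`2C₈₂` (`1/0.504 < 2`). [cite: Zhang2022LandauSiegel, §8 p.47, tex L2421] -/
theorem step8u040_holds {c' : ℝ} (hc' : 0 ≤ c') : Section8cStatements.Step8u040 c' := by
  unfold Section8cStatements.Step8u040
  obtain ⟨C, D₀, h82⟩ := lemma82_holds hc'
  refine ⟨2 * C, max D₀ ⌈Real.exp 2⌉₊, fun D _ χ hD hq hp hA j hj d r hd hr hdr => ?_⟩
  have hD₀ : D₀ ≤ D := le_trans (le_max_left _ _) hD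
  have hL : 2 ≤ ell D := two_le_ell (le_trans (le_max_right _ _) hD)
  obtain ⟨hlogP1, -, hP1PT, -, hP1T, -, hP1P, -⟩ := params hL
  have hL0 : 0 < ell D := by linarith
  have hT0 : 0 < bigT D := Real.exp_pos _
  have hdr1 : 1 ≤ d * r := Nat.one_le_iff_ne_zero.mpr (Nat.mul_ne_zero (by omega) (by omega))
  have hdr0 : (0 : ℝ) < ((d * r : ℕ) : ℝ) := by exact_mod_cast hdr1
  set x : ℝ := Skeleton.P1 D / ((d * r : ℕ) : ℝ) with hx
  have hP1x : Skeleton.P1 D = ((d * r : ℕ) : ℝ) * x := by rw [hx]; field_simp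
  have hxT : bigT D < x := by
    rw [hx, lt_div_iff₀ hdr0]; rw [lt_div_iff₀ hT0] at hdr; linarith
  have hP1pos : 0 < Skeleton.P1 D := Real.rpow_pos_of_pos (Real.exp_pos _) _
  have hxle : x ≤ Skeleton.P1 D := div_le_self hP1pos.le (by exact_mod_cast hdr1)
  have hxP : x < bigP D := lt_of_le_of_lt hxle hP1P
  have hT1 : 1 < bigT D := by
    rw [bigT]; exact Real.one_lt_exp_iff.mpr (by positivity)
  have hP1one : 1 < Skeleton.P1 D := lt_of_lt_of_le (lt_trans hT1 hxT) hxle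
  have key := h82 D χ hD₀ hq hp hA j hj 6 (by simp) x hxT hxP
  have hC0 : 0 ≤ C := by
    have := (norm_nonneg _).trans key
    have h6 : 0 < (ell D ^ 6)⁻¹ := by positivity
    nlinarith
  -- the sum of `S_j` is `(log P₁)⁻¹ ×` the sum of Lemma 8.2
  have hsub : Finset.Ico 1 ⌈x⌉₊ ⊆ Finset.Ico 1 (Nsupp D) := Ico_ceil_subset hP1PT hdr1
  have hsum : (∑ m ∈ Finset.Ico 1 (Nsupp D),
        χ (m : ZMod D) * vk1 D (d * r * m) / (m : ℂ) ^ (1 - betaJ c' D j)) =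
      (1 / (Real.log (Skeleton.P1 D) : ℂ)) *
        ∑ m ∈ Finset.Ico 1 ⌈x⌉₊, χ (m : ZMod D) / (m : ℂ) ^ (1 - betaJ c' D j) *
          ((x / m : ℝ) : ℂ) ^ betaMu D 6 * (Real.log (x / m) : ℂ) := by
    rw [Finset.mul_sum]
    symm
    apply Finset.sum_subset_zero_on_sdiff hsub
    · intro m hm
      rw [Finset.mem_sdiff, Finset.mem_Ico, Finset.mem_Ico, not_and, not_lt] at hm
      have hxm : x ≤ m := Nat.ceil_le.mp (hm.2 hm.1.1)
      have hm1 : (1 : ℝ) ≤ m := by exact_mod_cast hm.1.1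
      have : Skeleton.P1 D ≤ ((d * r * m : ℕ) : ℝ) := by
        rw [hP1x]; push_cast
        exact mul_le_mul_of_nonneg_left hxm (by positivity)
      rw [vk1_mul_eq_zero this, mul_zero, zero_div]
    · intro m hm
      rw [Finset.mem_Ico] at hm
      have hm1 : 1 ≤ m := hm.1
      have hmx : (m : ℝ) < x := Nat.lt_ceil.mp hm.2
      have hm0 : (0 : ℝ) < m := by exact_mod_cast hm1
      have hdrm : ((d * r * m : ℕ) : ℝ) < Skeleton.P1 D := by
        rw [hP1x]; push_cast
        have := mul_lt_mul_of_pos_left hmx hdr0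
        push_cast at this; linarith
      rw [vk1_mul_eq hP1one hdr1 hm1 hdrm]
      have hb : betaMu D 6 = beta6 D := by simp [betaMu]
      rw [hb, show Skeleton.P1 D / ((d * r : ℕ) : ℝ) / m = x / m by rw [hx]]
      ring
  have hlog0 : 0 < Real.log (Skeleton.P1 D) := by rw [hlogP1]; positivity
  rw [hsum, show (1 / (Real.log (Skeleton.P1 D) : ℂ)) *
        (∑ m ∈ Finset.Ico 1 ⌈x⌉₊, χ (m : ZMod D) / (m : ℂ) ^ (1 - betaJ c' D j) *
          ((x / m : ℝ) : ℂ) ^ betaMu D 6 * (Real.log (x / m) : ℂ)) -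
        deriv χ.LFunction 1 / (Real.log (Skeleton.P1 D) : ℂ) * frakfW c' D j 6 x =
      (1 / (Real.log (Skeleton.P1 D) : ℂ)) *
        ((∑ m ∈ Finset.Ico 1 ⌈x⌉₊, χ (m : ZMod D) / (m : ℂ) ^ (1 - betaJ c' D j) *
          ((x / m : ℝ) : ℂ) ^ betaMu D 6 * (Real.log (x / m) : ℂ)) -
          deriv χ.LFunction 1 * frakfW c' D j 6 x) by ring, norm_mul]
  have hn : ‖(1 / (Real.log (Skeleton.P1 D) : ℂ))‖ = 1 / Real.log (Skeleton.P1 D) := by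
    rw [norm_div, norm_one, Complex.norm_real, Real.norm_eq_abs, abs_of_pos hlog0]
  rw [hn]
  calc 1 / Real.log (Skeleton.P1 D) * ‖(∑ m ∈ Finset.Ico 1 ⌈x⌉₊,
          χ (m : ZMod D) / (m : ℂ) ^ (1 - betaJ c' D j) * ((x / m : ℝ) : ℂ) ^ betaMu D 6 *
            (Real.log (x / m) : ℂ)) - deriv χ.LFunction 1 * frakfW c' D j 6 x‖
      ≤ 1 / Real.log (Skeleton.P1 D) * (C * (ell D ^ 6)⁻¹) :=
        mul_le_mul_of_nonneg_left key (by positivity)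
    _ = C / 0.504 * (ell D ^ 15)⁻¹ := by rw [hlogP1]; field_simp
    _ ≤ 2 * C * (ell D ^ 15)⁻¹ := by
        apply mul_le_mul_of_nonneg_right _ (by positivity)
        rw [div_le_iff₀ (by norm_num)]; nlinarith

/-- **`Z22:§8.u041` DISCHARGED** (`Section8cStatements.Step8u041 c′`, for `c′ ≥ 0`):
"… and `x = P₂/dr` respectively: `Σ_m χ(m)ϰ₂(drm)/m^{1−β_j} = (L′(1,χ)/log P₂)𝓕_{j7}(P₂/dr) + O(𝓛⁻¹⁵)`
if `dr < P₂/T`" — from the tree's Lemma 8.2 at `μ = 7` and (8.6); constant `4C₈₂`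
(`log P₂ = 0.5𝓛⁹ − 10𝓛^{1.1} ≥ 𝓛⁹/4`). [cite: Zhang2022LandauSiegel, §8 p.47, tex L2425] -/
theorem step8u041_holds {c' : ℝ} (hc' : 0 ≤ c') : Section8cStatements.Step8u041 c' := by
  unfold Section8cStatements.Step8u041
  obtain ⟨C, D₀, h82⟩ := lemma82_holds hc'
  refine ⟨4 * C, max D₀ ⌈Real.exp 2⌉₊, fun D _ χ hD hq hp hA j hj d r hd hr hdr => ?_⟩
  have hD₀ : D₀ ≤ D := le_trans (le_max_left _ _) hD
  have hL : 2 ≤ ell D := two_le_ell (le_trans (le_max_right _ _) hD)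
  obtain ⟨-, hlogP2, -, hP2PT, -, hP2T, -, hP2P⟩ := params hL
  have hL0 : 0 < ell D := by linarith
  have hT0 : 0 < bigT D := Real.exp_pos _
  have hdr1 : 1 ≤ d * r := Nat.one_le_iff_ne_zero.mpr (Nat.mul_ne_zero (by omega) (by omega))
  have hdr0 : (0 : ℝ) < ((d * r : ℕ) : ℝ) := by exact_mod_cast hdr1
  set x : ℝ := Skeleton.P2 D / ((d * r : ℕ) : ℝ) with hx
  have hP2x : Skeleton.P2 D = ((d * r : ℕ) : ℝ) * x := by rw [hx]; field_simp
  have hxT : bigT D < x := by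
    rw [hx, lt_div_iff₀ hdr0]; rw [lt_div_iff₀ hT0] at hdr; linarith
  have hP2pos : 0 < Skeleton.P2 D :=
    div_pos (Real.rpow_pos_of_pos (Real.exp_pos _) _) (pow_pos (Real.exp_pos _) _)
  have hxle : x ≤ Skeleton.P2 D := div_le_self hP2pos.le (by exact_mod_cast hdr1)
  have hxP : x < bigP D := lt_of_le_of_lt hxle hP2P
  have hT1 : 1 < bigT D := by
    rw [bigT]; exact Real.one_lt_exp_iff.mpr (by positivity)
  have hP2one : 1 < Skeleton.P2 D := lt_of_lt_of_le (lt_trans hT1 hxT) hxle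
  have key := h82 D χ hD₀ hq hp hA j hj 7 (by simp) x hxT hxP
  have hC0 : 0 ≤ C := by
    have := (norm_nonneg _).trans key
    have h6 : 0 < (ell D ^ 6)⁻¹ := by positivity
    nlinarith
  -- the sum of `S_j` is `(log P₁)⁻¹ ×` the sum of Lemma 8.2
  have hsub : Finset.Ico 1 ⌈x⌉₊ ⊆ Finset.Ico 1 (Nsupp D) := Ico_ceil_subset hP2PT hdr1
  have hsum : (∑ m ∈ Finset.Ico 1 (Nsupp D),
        χ (m : ZMod D) * vk2 D (d * r * m) / (m : ℂ) ^ (1 - betaJ c' D j)) =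
      (1 / (Real.log (Skeleton.P2 D) : ℂ)) *
        ∑ m ∈ Finset.Ico 1 ⌈x⌉₊, χ (m : ZMod D) / (m : ℂ) ^ (1 - betaJ c' D j) *
          ((x / m : ℝ) : ℂ) ^ betaMu D 7 * (Real.log (x / m) : ℂ) := by
    rw [Finset.mul_sum]
    symm
    apply Finset.sum_subset_zero_on_sdiff hsub
    · intro m hm
      rw [Finset.mem_sdiff, Finset.mem_Ico, Finset.mem_Ico, not_and, not_lt] at hm
      have hxm : x ≤ m := Nat.ceil_le.mp (hm.2 hm.1.1)
      have hm1 : (1 : ℝ) ≤ m := by exact_mod_cast hm.1.1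
      have : Skeleton.P2 D ≤ ((d * r * m : ℕ) : ℝ) := by
        rw [hP2x]; push_cast
        exact mul_le_mul_of_nonneg_left hxm (by positivity)
      rw [vk2_mul_eq_zero this, mul_zero, zero_div]
    · intro m hm
      rw [Finset.mem_Ico] at hm
      have hm1 : 1 ≤ m := hm.1
      have hmx : (m : ℝ) < x := Nat.lt_ceil.mp hm.2
      have hm0 : (0 : ℝ) < m := by exact_mod_cast hm1
      have hdrm : ((d * r * m : ℕ) : ℝ) < Skeleton.P2 D := by
        rw [hP2x]; push_cast
        have := mul_lt_mul_of_pos_left hmx hdr0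
        push_cast at this; linarith
      rw [vk2_mul_eq hP2one hdr1 hm1 hdrm]
      have hb : betaMu D 7 = beta7 D := by simp [betaMu]
      rw [hb, show Skeleton.P2 D / ((d * r : ℕ) : ℝ) / m = x / m by rw [hx]]
      ring
  have hlog0 : 0 < Real.log (Skeleton.P2 D) := lt_of_lt_of_le (by positivity) hlogP2
  rw [hsum, show (1 / (Real.log (Skeleton.P2 D) : ℂ)) *
        (∑ m ∈ Finset.Ico 1 ⌈x⌉₊, χ (m : ZMod D) / (m : ℂ) ^ (1 - betaJ c' D j) *
          ((x / m : ℝ) : ℂ) ^ betaMu D 7 * (Real.log (x / m) : ℂ)) -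
        deriv χ.LFunction 1 / (Real.log (Skeleton.P2 D) : ℂ) * frakfW c' D j 7 x =
      (1 / (Real.log (Skeleton.P2 D) : ℂ)) *
        ((∑ m ∈ Finset.Ico 1 ⌈x⌉₊, χ (m : ZMod D) / (m : ℂ) ^ (1 - betaJ c' D j) *
          ((x / m : ℝ) : ℂ) ^ betaMu D 7 * (Real.log (x / m) : ℂ)) -
          deriv χ.LFunction 1 * frakfW c' D j 7 x) by ring, norm_mul]
  have hn : ‖(1 / (Real.log (Skeleton.P2 D) : ℂ))‖ = 1 / Real.log (Skeleton.P2 D) := by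
    rw [norm_div, norm_one, Complex.norm_real, Real.norm_eq_abs, abs_of_pos hlog0]
  rw [hn]
  have hL9 : 0 < ell D ^ 9 := by positivity
  have hinv : 1 / Real.log (Skeleton.P2 D) ≤ 4 / ell D ^ 9 := by
    rw [div_le_div_iff₀ hlog0 hL9]; linarith
  calc 1 / Real.log (Skeleton.P2 D) * ‖(∑ m ∈ Finset.Ico 1 ⌈x⌉₊,
          χ (m : ZMod D) / (m : ℂ) ^ (1 - betaJ c' D j) * ((x / m : ℝ) : ℂ) ^ betaMu D 7 *
            (Real.log (x / m) : ℂ)) - deriv χ.LFunction 1 * frakfW c' D j 7 x‖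
      ≤ 4 / ell D ^ 9 * (C * (ell D ^ 6)⁻¹) :=
        mul_le_mul hinv key (norm_nonneg _) (by positivity)
    _ = 4 * C * (ell D ^ 15)⁻¹ := by field_simp

end Literature.NumberTheory.LFunctions.Zhang2022.Section8FrontEnd82
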